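import Mathlib

/-!
# HistoryTailL — crux-ideate seat 1, gen 5: the POINTWISE-CONVEXITY HORIZON (toy model, kernel-checked)

Seat `ym-cruxidea-18916-1`, crux `stmt-QuantumFields-18916` (Ideas index) → live K2 `stmt-QuantumFields-19936`
`Summit.QuantumFields.YangMills.Theses.UnitScaleTilt.HistoryTailL`, STUB A `stub_jointRateHigh` of `Lines/birth_v5q.lean`.

This file is the checkable kernel of the gen-5 BARRIER NOTE «pointwise-convexity horizon» (answer to the sibling memo
`ym-cruxidea-18916-2/memos/memo-schur-obstruction-card6.md` v1–v4, kit j270026/j270331/j270427) and of the gen-5 amendment of card 6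
`multiscale-relative-convexity-herbst`.  It contains NO statement about gauge fields; it isolates the mechanism in three real variables.

## Dictionary (toy ↔ SU(2)₃ Wilson measure at `β = β_K = 1/g_K²`, lattice units)
* `b`  ↔ one SOFT horizontal mode of momentum `k` (stiffness `κₛ = β k²`, up to the lattice dispersion);
* `a₁, a₂` ↔ two UV modes (stiffness `κ = β·O(1)`), Gibbs-distributed with `E aᵢ² = 1/κ = O(g²)`;
* `λ·b·a₁·a₂` ↔ the cubic (`V₃`) vertex of the Wilson action (absent for `U(1)`);
* `schurSoft` ↔ the Schur complement of the pointwise Hessian onto the soft direction (what ANY pointwise criterion —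
  Bakry–Émery `CD(ρ,∞)`, Brascamp–Lieb, card 6's `(1−ε)`-relative convexity, Helffer–Sjöstrand with pointwise bounds — gets to use);
* `bubble = λ²/κ²` ↔ the two-vertex one-loop term at zero soft momentum, `= Σ_UV (vertex)²/(stiffness)² = O(β g²) = O(1)` per unit soft norm
  (measured by the sibling: total-space deficit `≈ 1.5`, pointed-quotient deficit `≈ 0.95`, β-independent, kit j270026/j270331);
* `gammaPP = Γ''(0)` ↔ the curvature of the soft mode's EFFECTIVE action after the UV modes are integrated out (gauge invariance of the
  effective action forbids a `k⁰` term there: in the lattice theory `Γ'' = β_eff k² ≥ 0`; in the toy `Γ'' = κₛ − bubble`).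

## What is proved (all `sorry`-free)
§1  `integral_schurSoft`:  `E[schurSoft] = Γ''(0) − bubble`  — the AVERAGED pointwise Schur complement sits exactly one bubble BELOW the
    effective curvature (the pointwise Hessian double-counts the two-vertex term: second-order perturbation in a frozen background carries no
    symmetry factor ½), and `bubble > 0` strictly (`bubble_pos`): so wherever `Γ'' ≈ βk²` (gauge invariance) the averaged pointwise Schur
    complement is `βk² − c`, NEGATIVE for `βk² < c` ⟺ `k < √c·g_K` ⟺ heights `j ≳ K/2 + ½ log_L(c/γ)`.
    `hasDerivAt_gammaEff`, `hasDerivAt_gammaEff_deriv_zero`: the calculus behind `Γ''(0) = κₛ − λ²/κ²`.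
§2  `inv_le_integral_inv`: for `S > 0`, `E[1/S] ≥ 1/E[S]` (the elementary Jensen floor, proved by `1/S ≥ 2/m − S/m²`).  Consequence
    (`bl_floor`): a Brascamp–Lieb variance bound `Var(b) ≤ E[(Hess)⁻¹_bb] = E[1/schurSoft]` can never certify a variance below
    `1/(βk² − c)`; for `βk² ≤ c` it certifies nothing (and `CD(ρ,∞)`, which needs `schurSoft ≥ ρ > 0` pointwise, fails on a set of positive
    measure).  This is the horizon: NO pointwise-Hessian criterion on the fine Wilson measure reaches heights above `≈ K/2`; `closes` needs `K(1 − 1/m)`.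
Evasions (recorded in the barrier note, not formalised): integrate the UV modes gauge-covariantly BEFORE testing convexity (Bałaban RG = the
(α)-lane; per-step log-concavity, 19201 card 3); abelian groups (`λ = 0`).
-/

namespace Summit.QuantumFields.YangMills.Cruxes.HistoryTailL.IdeaConvexityHorizonG5

open MeasureTheory

/-! ## §1 The three-variable toy model -/

/-- Toy action: one soft mode `b`, two UV modes `a₁ a₂`, one cubic vertex. -/
noncomputable def toyS (κs κ lam b a₁ a₂ : ℝ) : ℝ :=
  κs * b ^ 2 / 2 + κ * (a₁ ^ 2 + a₂ ^ 2) / 2 + lam * b * a₁ * a₂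

/-- Pointwise Schur complement of `Hess toyS` onto the soft direction at a point with `b = 0`: the Hessian there is
`[[κₛ, λa₂, λa₁], [λa₂, κ, 0], [λa₁, 0, κ]]`, so the complement of the UV block `κ·I` is `κₛ − λ²(a₁² + a₂²)/κ`. -/
noncomputable def schurSoft (κs κ lam a₁ a₂ : ℝ) : ℝ :=
  κs - lam ^ 2 * (a₁ ^ 2 + a₂ ^ 2) / κ

/-- The Schur complement formula, checked against the `3 × 3` Hessian: for every soft test amplitude `x`, minimising the quadratic form
`Hess toyS (x, y₁, y₂)` over the UV components gives `schurSoft · x²` (the minimiser is `yᵢ = −λ aⱼ x/κ`). -/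
theorem hess_quadratic_ge_schur {κs κ lam a₁ a₂ : ℝ} (hκ : 0 < κ) (x y₁ y₂ : ℝ) :
    schurSoft κs κ lam a₁ a₂ * x ^ 2 ≤
      κs * x ^ 2 + κ * (y₁ ^ 2 + y₂ ^ 2) + 2 * lam * a₂ * x * y₁ + 2 * lam * a₁ * x * y₂ := by
  unfold schurSoft
  have hκ0 : κ ≠ 0 := hκ.ne'
  have key : κs * x ^ 2 + κ * (y₁ ^ 2 + y₂ ^ 2) + 2 * lam * a₂ * x * y₁ + 2 * lam * a₁ * x * y₂
      - (κs - lam ^ 2 * (a₁ ^ 2 + a₂ ^ 2) / κ) * x ^ 2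
      = κ * (y₁ + lam * a₂ * x / κ) ^ 2 + κ * (y₂ + lam * a₁ * x / κ) ^ 2 := by
    field_simp
    ring
  have hnn : 0 ≤ κ * (y₁ + lam * a₂ * x / κ) ^ 2 + κ * (y₂ + lam * a₁ * x / κ) ^ 2 := by positivity
  linarith

/-- … and the bound is attained (so `schurSoft` IS the Schur complement, not merely a lower bound). -/
theorem hess_quadratic_eq_schur_at_min {κs κ lam a₁ a₂ : ℝ} (hκ : 0 < κ) (x : ℝ) :
    κs * x ^ 2 + κ * ((-(lam * a₂ * x / κ)) ^ 2 + (-(lam * a₁ * x / κ)) ^ 2)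
      + 2 * lam * a₂ * x * (-(lam * a₂ * x / κ)) + 2 * lam * a₁ * x * (-(lam * a₁ * x / κ))
      = schurSoft κs κ lam a₁ a₂ * x ^ 2 := by
  unfold schurSoft
  have hκ0 : κ ≠ 0 := hκ.ne'
  field_simp
  ring

/-- One-loop effective action of the soft mode: integrating `exp(−toyS)` over `(a₁,a₂)` (Gaussian with precision matrix
`[[κ, λb],[λb, κ]]`) gives, up to an additive constant, `Γ(b) = ½κₛb² + ½ log(κ² − λ²b²)`. -/
noncomputable def gammaEff (κs κ lam b : ℝ) : ℝ :=
  κs * b ^ 2 / 2 + Real.log (κ ^ 2 - lam ^ 2 * b ^ 2) / 2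

/-- `Γ''(0)`. -/
noncomputable def gammaPP (κs κ lam : ℝ) : ℝ := κs - lam ^ 2 / κ ^ 2

/-- The two-vertex («gluon bubble») term at zero soft momentum. -/
noncomputable def bubble (κ lam : ℝ) : ℝ := lam ^ 2 / κ ^ 2

/-- The bubble is STRICTLY positive as soon as there is a cubic vertex (non-abelian) — no Ward identity needed for the sign. -/
theorem bubble_pos {κ lam : ℝ} (hκ : κ ≠ 0) (hl : lam ≠ 0) : 0 < bubble κ lam := by
  unfold bubble
  have h1 : 0 < lam ^ 2 := lt_of_le_of_ne (sq_nonneg _) (Ne.symm (pow_ne_zero 2 hl))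
  have h2 : 0 < κ ^ 2 := lt_of_le_of_ne (sq_nonneg _) (Ne.symm (pow_ne_zero 2 hκ))
  exact div_pos h1 h2

/-- No cubic vertex (abelian toy): no bubble, no horizon. -/
theorem bubble_eq_zero_of_abelian (κ : ℝ) : bubble κ 0 = 0 := by
  simp [bubble]

/-- `Γ'(b) = κₛ b − λ² b/(κ² − λ² b²)` on the domain `κ² − λ²b² > 0`. -/
theorem hasDerivAt_gammaEff (κs κ lam b : ℝ) (h : 0 < κ ^ 2 - lam ^ 2 * b ^ 2) :
    HasDerivAt (gammaEff κs κ lam) (κs * b - lam ^ 2 * b / (κ ^ 2 - lam ^ 2 * b ^ 2)) b := by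
  have h1 : HasDerivAt (fun x : ℝ => κs * x ^ 2 / 2) (κs * b) b :=
    (((hasDerivAt_pow 2 b).const_mul κs).div_const 2).congr_deriv (by norm_num; ring)
  have hin : HasDerivAt (fun x : ℝ => κ ^ 2 - lam ^ 2 * x ^ 2) (-(lam ^ 2 * (2 * b))) b :=
    (((hasDerivAt_pow 2 b).const_mul (lam ^ 2)).const_sub (κ ^ 2)).congr_deriv (by norm_num)
  have h2 : HasDerivAt (fun x : ℝ => Real.log (κ ^ 2 - lam ^ 2 * x ^ 2) / 2)
      (-(lam ^ 2 * (2 * b)) / (κ ^ 2 - lam ^ 2 * b ^ 2) / 2) b :=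
    (hin.log h.ne').div_const 2
  show HasDerivAt (fun x : ℝ => κs * x ^ 2 / 2 + Real.log (κ ^ 2 - lam ^ 2 * x ^ 2) / 2) _ b
  exact (h1.add h2).congr_deriv (by ring)

/-- `Γ''(0) = κₛ − λ²/κ² = gammaPP`: the derivative of `Γ'` at `b = 0`. -/
theorem hasDerivAt_gammaEff_deriv_zero (κs κ lam : ℝ) (hκ : κ ≠ 0) :
    HasDerivAt (fun b : ℝ => κs * b - lam ^ 2 * b / (κ ^ 2 - lam ^ 2 * b ^ 2)) (gammaPP κs κ lam) 0 := by
  have hκ2 : κ ^ 2 ≠ 0 := pow_ne_zero 2 hκ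
  have h1 : HasDerivAt (fun b : ℝ => κs * b) κs 0 :=
    ((hasDerivAt_id (0 : ℝ)).const_mul κs).congr_deriv (by simp)
  have hc : HasDerivAt (fun b : ℝ => lam ^ 2 * b) (lam ^ 2) 0 :=
    ((hasDerivAt_id (0 : ℝ)).const_mul (lam ^ 2)).congr_deriv (by simp)
  have hd : HasDerivAt (fun b : ℝ => κ ^ 2 - lam ^ 2 * b ^ 2) 0 0 :=
    (((hasDerivAt_pow 2 (0 : ℝ)).const_mul (lam ^ 2)).const_sub (κ ^ 2)).congr_deriv (by norm_num)
  have hd0 : (fun b : ℝ => κ ^ 2 - lam ^ 2 * b ^ 2) 0 ≠ 0 := by simpa using hκ2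
  have h2 : HasDerivAt (fun b : ℝ => lam ^ 2 * b / (κ ^ 2 - lam ^ 2 * b ^ 2)) (lam ^ 2 / κ ^ 2) 0 := by
    refine (hc.div hd hd0).congr_deriv ?_
    field_simp
    ring
  exact (h1.sub h2).congr_deriv (by unfold gammaPP; ring)

/-- THE IDENTITY: `(averaged pointwise Schur) = Γ''(0) − bubble`, i.e. `κₛ − 2λ²/κ² = (κₛ − λ²/κ²) − λ²/κ²`. -/
theorem avgSchur_eq_gammaPP_sub_bubble (κs κ lam : ℝ) :
    κs - 2 * (lam ^ 2 / κ ^ 2) = gammaPP κs κ lam - bubble κ lam := by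
  unfold gammaPP bubble
  ring

/-- The identity as a genuine expectation: under ANY law of the UV modes with second moments `E a₁² = E a₂² = 1/κ` (the Gibbs law of the
toy UV block), the mean of the pointwise Schur complement is `Γ''(0) − bubble`. -/
theorem integral_schurSoft {Ω : Type*} [MeasurableSpace Ω] (μ : Measure Ω) [IsProbabilityMeasure μ]
    {κs κ lam : ℝ} (hκ : κ ≠ 0) (a₁ a₂ : Ω → ℝ)
    (h1 : Integrable (fun ω => a₁ ω ^ 2) μ) (h2 : Integrable (fun ω => a₂ ω ^ 2) μ)
    (hm1 : ∫ ω, a₁ ω ^ 2 ∂μ = κ⁻¹) (hm2 : ∫ ω, a₂ ω ^ 2 ∂μ = κ⁻¹) :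
    ∫ ω, schurSoft κs κ lam (a₁ ω) (a₂ ω) ∂μ = gammaPP κs κ lam - bubble κ lam := by
  unfold schurSoft
  have hI : Integrable (fun ω => lam ^ 2 * (a₁ ω ^ 2 + a₂ ω ^ 2) / κ) μ :=
    ((h1.add h2).const_mul (lam ^ 2)).div_const κ
  rw [integral_sub (integrable_const κs) hI, integral_div, integral_const_mul, integral_add h1 h2, hm1, hm2]
  simp only [integral_const, probReal_univ, smul_eq_mul, one_mul]
  unfold gammaPP bubble
  field_simp
  ring

/-- HORIZON (toy form): if the effective curvature is the gauge-invariant `βk²` (no `k⁰` term) and the bubble is `c > 0`, the averaged pointwise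
Schur complement `βk² − c` is negative exactly when `βk² < c`. -/
theorem avgSchur_neg_iff {βk2 c : ℝ} : βk2 - c < 0 ↔ βk2 < c := sub_neg

/-! ## §2 The Jensen floor: what a pointwise criterion can certify -/

/-- `E[1/S] ≥ 1/E[S]` for a positive integrand, in the one-sided form used here: `E S ≤ m` ⇒ `E[1/S] ≥ 1/m`.
Proof: pointwise `1/S − (2/m − S/m²) = (m − S)²/(m² S) ≥ 0`, then integrate. -/
theorem inv_le_integral_inv {Ω : Type*} [MeasurableSpace Ω] (μ : Measure Ω) [IsProbabilityMeasure μ]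
    {S : Ω → ℝ} {m : ℝ} (hm : 0 < m) (hS : ∀ ω, 0 < S ω)
    (hint : Integrable S μ) (hinv : Integrable (fun ω => (S ω)⁻¹) μ) (hle : ∫ ω, S ω ∂μ ≤ m) :
    m⁻¹ ≤ ∫ ω, (S ω)⁻¹ ∂μ := by
  have hm0 : m ≠ 0 := hm.ne'
  have hpt : ∀ ω, 2 / m - S ω / m ^ 2 ≤ (S ω)⁻¹ := by
    intro ω
    have hS0 : S ω ≠ 0 := (hS ω).ne'
    have key : (S ω)⁻¹ - (2 / m - S ω / m ^ 2) = (m - S ω) ^ 2 / (m ^ 2 * S ω) := by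
      field_simp
      ring
    have hnn : 0 ≤ (m - S ω) ^ 2 / (m ^ 2 * S ω) := by
      have := hS ω
      positivity
    linarith
  have hmono : ∫ ω, (2 / m - S ω / m ^ 2) ∂μ ≤ ∫ ω, (S ω)⁻¹ ∂μ :=
    integral_mono ((integrable_const _).sub (hint.div_const _)) hinv hpt
  have hcalc : ∫ ω, (2 / m - S ω / m ^ 2) ∂μ = 2 / m - (∫ ω, S ω ∂μ) / m ^ 2 := by
    rw [integral_sub (integrable_const _) (hint.div_const _), integral_div (m ^ 2) S]
    simp only [integral_const, probReal_univ, smul_eq_mul, one_mul]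
  rw [hcalc] at hmono
  have hstep : 2 / m - m / m ^ 2 ≤ 2 / m - (∫ ω, S ω ∂μ) / m ^ 2 := by
    gcongr
  have h3 : 2 / m - m / m ^ 2 = m⁻¹ := by
    field_simp
    ring
  linarith

/-- BRASCAMP–LIEB FLOOR.  If the averaged pointwise Schur complement is at most `βk² − c` with `0 < βk² − c` (the sub-horizon side), the best
variance bound a pointwise criterion can certify, `E[1/Schur]`, is at least `1/(βk² − c)`, hence exceeds the free value `1/(βk²)` by the factor
`βk²/(βk² − c)`; as `βk² ↓ c` the certified bound blows up, and for `βk² ≤ c` positivity of the Schur complement (needed even to write the bound)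
fails on average. -/
theorem bl_floor {Ω : Type*} [MeasurableSpace Ω] (μ : Measure Ω) [IsProbabilityMeasure μ]
    {Schur : Ω → ℝ} {βk2 c : ℝ} (hpos : ∀ ω, 0 < Schur ω) (hgap : c < βk2)
    (hint : Integrable Schur μ) (hinv : Integrable (fun ω => (Schur ω)⁻¹) μ)
    (havg : ∫ ω, Schur ω ∂μ ≤ βk2 - c) :
    (βk2 - c)⁻¹ ≤ ∫ ω, (Schur ω)⁻¹ ∂μ :=
  inv_le_integral_inv μ (sub_pos.mpr hgap) hpos hint hinv havg

/-- … and the certified bound is STRICTLY worse than the free variance `1/(βk²)` whenever `c > 0`. -/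
theorem free_lt_floor {βk2 c : ℝ} (hc : 0 < c) (hgap : c < βk2) : βk2⁻¹ < (βk2 - c)⁻¹ := by
  have h1 : 0 < βk2 - c := sub_pos.mpr hgap
  have h2 : 0 < βk2 := lt_trans hc hgap
  exact (inv_lt_inv₀ h2 h1).mpr (by linarith)

end Summit.QuantumFields.YangMills.Cruxes.HistoryTailL.IdeaConvexityHorizonG5
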